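import Summits.Ventures.PercRepro.Night2NearFatNineLine

/-!
# night-2: THE SEVEN-POINT LINE AT `|G| = 15` — the tools (gen 40)

The tools of the nine-point line at `|G| = 16` work at `|G| = 15` for a seven-point line: the line of a lossy big set with no
good point missing exactly nine points of `V` is the only line with `≥ 5` points (`clF_eq_of_nine_line_of_five`), so next
to a line of `≥ 7` points every load above level `|W| − 4` is a distance-1 load (`no_nine_line_of_long_line`); a basis pair
whose basis line carries five points of `W` (`|W| = 9`) has its other long basis line of `≤ 4` points, its classes of `≤ 6`
and the faces at the line's basis points of `≤ 4` points: the per-face family with the cells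
`ntpIncomeB 9 5 5 0 6 6 4 = 12927/10010`, `ntpIncomeB 9 5 5 4 6 6 4 = 6107/5148` (`basis_pair_fair_nine_seven_line`).  With
every line of `V` of `≤ 7` or `≥ 9` points, a lossy basis pair has a five-point basis line (the pair above) or all basis lines
`≤ 4` and classes `≤ 6` (`basis_pair_fair_top_nine`): **`localShadowHall_fifteen_of_no_eight_line`**.
Paper: proofs/NIGHT-2-g40.md §10.
-/

namespace PercRepro.Shadow

open PercRepro.ThmH PercRepro.PerFlat

variable {α : Type*} [DecidableEq α] {M : Matroid α} [M.Finite] {G : Finset α}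

/-- **The line of a lossy big set with no good point missing exactly nine points of `V` is the only line with `≥ 5` points**:
any rank-2 set `R₂ ⊆ V` whose line carries `≥ 5` points of `V` spans the same line (the three missed sets have exactly three
points each). -/
theorem clF_eq_of_nine_line_of_five (hG : G ∈ flatsQ M (5 + 1)) (hd : (gr M \ G).card = 2)
    (hk : kColoops M G = 1) (hs : ∀ e ∈ gr M, ∀ f ∈ gr M, e ≠ f → rkN M {e, f} = 2)
    (hl : ∀ e ∈ gr M, M.Indep {e}) (hnf : fatClosures M 5 G 2 = ∅)
    {B₁ : Finset α} (hB₁ : B₁ ∈ thinMembers M 5 G) (hbig₁ : 5 ≤ (B₁ \ coloops M G).card) {z₁ : α}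
    (hz₁ : z₁ ∈ G \ clF M B₁) (hloss₁ : loss M 5 G B₁ z₁ ≠ 0) {R₁ : Finset α}
    (hRQ₁ : R₁ ⊆ insert z₁ B₁ \ coloops M G) (hR2₁ : rkN M R₁ = 2)
    (hRcard₁ : R₁.card + 3 = (insert z₁ B₁ \ coloops M G).card) (hempty₁ : gtPts M 5 G (insert z₁ B₁) = ∅)
    (h9₁ : ((G \ coloops M G) ∩ clF M R₁).card + 9 = (G \ coloops M G).card)
    {R₂ : Finset α} (hR2₂ : rkN M R₂ = 2) (hR₂V : R₂ ⊆ G \ coloops M G)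
    (h6₂ : 5 ≤ ((G \ coloops M G) ∩ clF M R₂).card) :
    clF M R₁ = clF M R₂ := by
  obtain ⟨c, hc, d, hd', e, he, hcd, hce, hde, hcov, hS, hdisj⟩ :=
    missed_sets_of_gtPts_eq_empty hG hd hk hs hl hnf hB₁ hbig₁ hz₁ hloss₁ hRQ₁ hR2₁ hRcard₁ hempty₁
  have hGg : G ⊆ gr M := (mem_flatsQ.1 hG).1
  have hVg : G \ coloops M G ⊆ gr M := Finset.sdiff_subset.trans hGg
  have hQG : insert z₁ B₁ ⊆ G :=
    Finset.insert_subset (Finset.mem_sdiff.1 hz₁).1 (subset_G_of_mem_thinMembers hB₁)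
  have hR₁g : R₁ ⊆ gr M := hRQ₁.trans (Finset.sdiff_subset.trans (hQG.trans hGg))
  have hR₂g : R₂ ⊆ gr M := hR₂V.trans hVg
  set V := G \ coloops M G with hV
  set L₁ := V ∩ clF M R₁ with hL₁
  set L₂ := V ∩ clF M R₂ with hL₂
  -- each missed set has exactly three points: `|V| ≥ |L₁| + |S_c| + |S_d| + |S_e|`
  have hS3 : ∀ u ∈ coloops M (insert z₁ B₁ \ coloops M G), (G \ clF M ((insert z₁ B₁).erase u)).card ≤ 3 := by
    intro u hu
    -- the other two coloops
    have h3 := card_coloops_eq_three_of_loss_ne_zero hG hd hk hs hl hB₁ hbig₁ hz₁ hloss₁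
    have hC : coloops M (insert z₁ B₁ \ coloops M G) = {c, d, e} := by
      symm
      apply Finset.eq_of_subset_of_card_le
      · intro x hx
        simp only [Finset.mem_insert, Finset.mem_singleton] at hx
        rcases hx with rfl | rfl | rfl <;> assumption
      · rw [h3, Finset.card_eq_three.2 ⟨c, d, e, hcd, hce, hde, rfl⟩]
    have hothers : ∃ v ∈ coloops M (insert z₁ B₁ \ coloops M G), ∃ w ∈ coloops M (insert z₁ B₁ \ coloops M G),
        u ≠ v ∧ u ≠ w ∧ v ≠ w := by
      have hu' : u = c ∨ u = d ∨ u = e := by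
        rw [hC] at hu
        simpa using hu
      rcases hu' with rfl | rfl | rfl
      · exact ⟨d, hd', e, he, hcd, hce, hde⟩
      · exact ⟨c, hc, e, he, Ne.symm hcd, hde, hce⟩
      · exact ⟨c, hc, d, hd', Ne.symm hce, Ne.symm hde, hcd⟩
    obtain ⟨v, hv, w, hw, huv, huw, hvw⟩ := hothers
    set Su := G \ clF M ((insert z₁ B₁).erase u) with hSu
    set Sv := G \ clF M ((insert z₁ B₁).erase v) with hSv
    set Sw := G \ clF M ((insert z₁ B₁).erase w) with hSw
    have h1 : (L₁ ∪ Su).card = L₁.card + Su.card := by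
      have := Finset.card_union_add_card_inter L₁ Su
      have h0 : (L₁ ∩ Su).card = 0 := by
        rw [Finset.card_eq_zero, Finset.eq_empty_iff_forall_notMem]
        intro x hx
        rw [Finset.mem_inter] at hx
        exact (hS u hu).2.2 x hx.2 (Finset.mem_inter.1 hx.1).2
      omega
    have h2 : (L₁ ∪ Su ∪ Sv).card = L₁.card + Su.card + Sv.card := by
      have := Finset.card_union_add_card_inter (L₁ ∪ Su) Sv
      have h0 : ((L₁ ∪ Su) ∩ Sv).card = 0 := by
        rw [Finset.card_eq_zero, Finset.eq_empty_iff_forall_notMem]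
        intro x hx
        rw [Finset.mem_inter, Finset.mem_union] at hx
        rcases hx.1 with h | h
        · exact (hS v hv).2.2 x hx.2 (Finset.mem_inter.1 h).2
        · exact hdisj u hu v hv huv x h hx.2
      omega
    have h3 : (L₁ ∪ Su ∪ Sv ∪ Sw).card = L₁.card + Su.card + Sv.card + Sw.card := by
      have := Finset.card_union_add_card_inter (L₁ ∪ Su ∪ Sv) Sw
      have h0 : ((L₁ ∪ Su ∪ Sv) ∩ Sw).card = 0 := by
        rw [Finset.card_eq_zero, Finset.eq_empty_iff_forall_notMem]
        intro x hx
        rw [Finset.mem_inter, Finset.mem_union, Finset.mem_union] at hx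
        rcases hx.1 with (h | h) | h
        · exact (hS w hw).2.2 x hx.2 (Finset.mem_inter.1 h).2
        · exact hdisj u hu w hw huw x h hx.2
        · exact hdisj v hv w hw hvw x h hx.2
      omega
    have hsubV : L₁ ∪ Su ∪ Sv ∪ Sw ⊆ V :=
      Finset.union_subset (Finset.union_subset (Finset.union_subset Finset.inter_subset_left (hS u hu).2.1)
        (hS v hv).2.1) (hS w hw).2.1
    have hV' := Finset.card_le_card hsubV
    have hv3 : 3 ≤ Sv.card := (hS v hv).1
    have hw3 : 3 ≤ Sw.card := (hS w hw).1
    omega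
  -- the points of `V` on a plane through `L₁`: at most the line and the missed set
  have hplane : ∀ u ∈ coloops M (insert z₁ B₁ \ coloops M G),
      V ∩ clF M (insert u R₁) ⊆ L₁ ∪ (G \ clF M ((insert z₁ B₁).erase u)) :=
    fun u hu => inter_clF_insert_subset hG hd hk hs hl hB₁ hbig₁ hz₁ hloss₁ hRQ₁ hR2₁ hRcard₁ hu
  -- two distinct lines share at most one point of `V`
  by_contra hne
  have hshare : (L₂ ∩ L₁).card ≤ 1 := by
    by_contra hlt
    push Not at hlt
    obtain ⟨w, hw, w', hw', hww'⟩ := Finset.one_lt_card.1 hlt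
    rw [hL₂, hL₁, Finset.mem_inter, Finset.mem_inter, Finset.mem_inter] at hw hw'
    apply hne
    have hpair : ({w, w'} : Finset α) ⊆ gr M := by
      intro x hx
      rw [Finset.mem_insert, Finset.mem_singleton] at hx
      rcases hx with rfl | rfl
      · exact hVg hw.1.1
      · exact hVg hw'.1.1
    have hsub₁ : ({w, w'} : Finset α) ⊆ clF M R₁ := by
      intro x hx
      rw [Finset.mem_insert, Finset.mem_singleton] at hx
      rcases hx with rfl | rfl
      · exact hw.2.2
      · exact hw'.2.2
    have hsub₂ : ({w, w'} : Finset α) ⊆ clF M R₂ := by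
      intro x hx
      rw [Finset.mem_insert, Finset.mem_singleton] at hx
      rcases hx with rfl | rfl
      · exact hw.1.2
      · exact hw'.1.2
    have e₁ : clF M {w, w'} = clF M R₁ :=
      clF_eq_clF_of_subset_clF_of_rkN_le hR₁g hsub₁ (by rw [hR2₁, hs w (hVg hw.1.1) w' (hVg hw'.1.1) hww'])
    have e₂ : clF M {w, w'} = clF M R₂ :=
      clF_eq_clF_of_subset_clF_of_rkN_le hR₂g hsub₂ (by rw [hR2₂, hs w (hVg hw.1.1) w' (hVg hw'.1.1) hww'])
    rw [← e₁, ← e₂]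
  -- two points of `L₂` in a common plane through `L₁` put `L₂` inside that plane
  have hone : ∀ u ∈ coloops M (insert z₁ B₁ \ coloops M G), ((L₂ \ L₁) ∩ clF M (insert u R₁)).card ≤ 1 := by
    intro u hu
    rw [Finset.card_le_one]
    intro x hx y hy
    by_contra hxy
    rw [Finset.mem_inter, Finset.mem_sdiff, hL₂, Finset.mem_inter] at hx hy
    have hxV : x ∈ V := hx.1.1.1
    have hyV : y ∈ V := hy.1.1.1
    have hpair : ({x, y} : Finset α) ⊆ gr M := by
      intro v hv
      rw [Finset.mem_insert, Finset.mem_singleton] at hv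
      rcases hv with rfl | rfl
      · exact hVg hxV
      · exact hVg hyV
    have hsub₂ : ({x, y} : Finset α) ⊆ clF M R₂ := by
      intro v hv
      rw [Finset.mem_insert, Finset.mem_singleton] at hv
      rcases hv with rfl | rfl
      · exact hx.1.1.2
      · exact hy.1.1.2
    have e₂ : clF M {x, y} = clF M R₂ :=
      clF_eq_clF_of_subset_clF_of_rkN_le hR₂g hsub₂ (by rw [hR2₂, hs x (hVg hxV) y (hVg hyV) hxy])
    have hsubP : ({x, y} : Finset α) ⊆ clF M (insert u R₁) := by
      intro v hv
      rw [Finset.mem_insert, Finset.mem_singleton] at hv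
      rcases hv with rfl | rfl
      · exact hx.2
      · exact hy.2
    have hL₂P : L₂ ⊆ L₁ ∪ (G \ clF M ((insert z₁ B₁).erase u)) := by
      intro v hv
      rw [hL₂, Finset.mem_inter] at hv
      apply hplane u hu
      rw [Finset.mem_inter]
      refine ⟨hv.1, ?_⟩
      have : v ∈ clF M {x, y} := by rw [e₂]; exact hv.2
      have h' := clF_mono hsubP this
      rw [clF_clF] at h'
      exact h'
    have hcard := Finset.card_le_card hL₂P
    have hU := Finset.card_union_le L₁ (G \ clF M ((insert z₁ B₁).erase u))
    -- `|L₂| ≤ |L₂ ∩ L₁| + |S_u| ≤ 1 + 3`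
    have hsplit : L₂ ⊆ (L₂ ∩ L₁) ∪ (G \ clF M ((insert z₁ B₁).erase u)) := by
      intro v hv
      rcases Finset.mem_union.1 (hL₂P hv) with h | h
      · exact Finset.mem_union_left _ (Finset.mem_inter.2 ⟨hv, h⟩)
      · exact Finset.mem_union_right _ h
    have h1 := Finset.card_le_card hsplit
    have h2 := Finset.card_union_le (L₂ ∩ L₁) (G \ clF M ((insert z₁ B₁).erase u))
    have h3 := hS3 u hu
    omega
  -- the points of `L₂` off `L₁` lie in the three planes, at most one each
  have hcover : L₂ \ L₁ ⊆ ((L₂ \ L₁) ∩ clF M (insert c R₁)) ∪ ((L₂ \ L₁) ∩ clF M (insert d R₁)) ∪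
      ((L₂ \ L₁) ∩ clF M (insert e R₁)) := by
    intro x hx
    have hxV : x ∈ V := by
      have h := (Finset.mem_sdiff.1 hx).1
      rw [hL₂, Finset.mem_inter] at h
      exact h.1
    have h := hcov hxV
    rw [Finset.mem_union, Finset.mem_union] at h
    rw [Finset.mem_union, Finset.mem_union, Finset.mem_inter, Finset.mem_inter, Finset.mem_inter]
    tauto
  have hc3 := Finset.card_le_card hcover
  have hc3' := Finset.card_union_le (((L₂ \ L₁) ∩ clF M (insert c R₁)) ∪ ((L₂ \ L₁) ∩ clF M (insert d R₁)))
    ((L₂ \ L₁) ∩ clF M (insert e R₁))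
  have hc3'' := Finset.card_union_le ((L₂ \ L₁) ∩ clF M (insert c R₁)) ((L₂ \ L₁) ∩ clF M (insert d R₁))
  have hc1 := hone c hc
  have hd1 := hone d hd'
  have he1 := hone e he
  have hsd := Finset.card_sdiff_add_card_inter L₂ L₁
  omega



/-- **No nine-missing line next to a line of `≥ 7` points** (`|V| ≤ 15`). -/
theorem no_nine_line_of_long_line (hG : G ∈ flatsQ M (5 + 1)) (hd : (gr M \ G).card = 2)
    (hk : kColoops M G = 1) (hs : ∀ e ∈ gr M, ∀ f ∈ gr M, e ≠ f → rkN M {e, f} = 2)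
    (hl : ∀ e ∈ gr M, M.Indep {e}) (hnf : fatClosures M 5 G 2 = ∅) (h15 : (G \ coloops M G).card ≤ 15)
    {u v : α} (hu : u ∈ G \ coloops M G) (hv : v ∈ G \ coloops M G) (huv : u ≠ v)
    (h7 : 7 ≤ ((G \ coloops M G) ∩ clF M {u, v}).card) :
    ¬ ∃ B' ∈ thinMembers M 5 G, 5 ≤ (B' \ coloops M G).card ∧ ∃ z' ∈ G \ clF M B',
      loss M 5 G B' z' ≠ 0 ∧ gtPts M 5 G (insert z' B') = ∅ ∧ ∃ R ⊆ insert z' B' \ coloops M G, rkN M R = 2 ∧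
        R.card + 3 = (insert z' B' \ coloops M G).card ∧
        ((G \ coloops M G) ∩ clF M R).card + 9 = (G \ coloops M G).card := by
  rintro ⟨B', hB', hbig, z', hz', hloss, hempty, R, hRQ, hR2, hRcard, h9⟩
  have hGg : G ⊆ gr M := (mem_flatsQ.1 hG).1
  have hpair : ({u, v} : Finset α) ⊆ G \ coloops M G := by
    intro e he
    rw [Finset.mem_insert, Finset.mem_singleton] at he
    rcases he with rfl | rfl
    · exact hu
    · exact hv
  have hcl := clF_eq_of_nine_line_of_five hG hd hk hs hl hnf hB' hbig hz' hloss hRQ hR2 hRcard hempty h9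
    (R₂ := {u, v}) (hs u (hGg (Finset.mem_sdiff.1 hu).1) v (hGg (Finset.mem_sdiff.1 hv).1) huv) hpair (by omega)
  rw [hcl] at h9
  omega

/-- The cell `(5, 0, 6, 6; f = 4)` at `N = 9`, `s = 5`: `12927/10010`. -/
theorem one_le_ntpIncomeB_nine_five_zero : 1 ≤ ntpIncomeB 9 5 5 0 6 6 4 := by
  unfold ntpIncomeB suspBound
  simp only [Finset.sum_range_succ, Finset.sum_range_zero]
  norm_num [Nat.choose, max_def]

/-- The cell `(5, 4, 6, 6; f = 4)` at `N = 9`, `s = 5`: `6107/5148`. -/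
theorem one_le_ntpIncomeB_nine_five_four : 1 ≤ ntpIncomeB 9 5 5 4 6 6 4 := by
  unfold ntpIncomeB suspBound
  simp only [Finset.sum_range_succ, Finset.sum_range_zero]
  norm_num [Nat.choose, max_def]

end PercRepro.Shadow
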